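import Summits.BirchSwinnertonDyer.BirchSwinnertonDyer.Theorems.EisensteinPrimesIndexPlumbingNrVsStrict
import Summits.BirchSwinnertonDyer.BirchSwinnertonDyer.Theorems.EisensteinPrimesAnomalousUnramifiedKernelFinite
import Summits.BirchSwinnertonDyer.BirchSwinnertonDyer.Theorems.EisensteinPrimesIndexInputsAnomalousQuotient
import Summits.BirchSwinnertonDyer.BirchSwinnertonDyer.Theorems.EisensteinPrimesResidualPairStableLine
import HarnessLib

/-!
# Route `EisensteinPrimes`, crux 2 `GoodLatticeBDPValue` (stmt-BirchSwinnertonDyer-19032), line `halves` v20, stub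
# `stub_indexPlumbing` part (B1), AT THE CRUX BINDERS: `λ(𝔛^{Sf}_nr(𝟙̃)) ≤ corank_{ℤ_p} R((F/𝒪)(𝟙̃)) + p^c`
# on the anticyclotomic tower at the good anomalous place `v̄`

Cell `bsd-eis` (home `run/shared/lean/pub/bsd-eis/`), width seat `bsd-line-x1-p1-w8` («width 8»; `--supports -19032`,
closes nothing). Sequel of `…IndexPlumbingNrVsStrict` (p649735): its two displayed hypotheses are discharged on the binders of
Keller–Yin Thm. 1.4.1 / the LEAD's registered `stub_indexPlumbing` (`Cruxes/GoodLatticeBDPValue/Lines/halves.lean` v20,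
sha256 a012386a…, l.361):
* `hgen` — a topological generator of `ker κ ⊓ D_v̄` modulo its inertia subgroup: w2 gen 3's
  `AnomalousLocalTorsion.exists_generator_decomp_inf_kerSubgroup` (p644730; any `κ` with `κ(I_v̄) ≠ 1`), transported from
  `D_v̄ ⊓ ker κ` to `ker κ ⊓ D_v̄` (`exists_generator_kerSubgroup_inf_decomp`), and its anticyclotomic instance
  (`κ(I_v̄) ≠ 1` by `ZpExtension.exists_mem_inertia_apply_ne_one_of_isAnticyclotomic`, Brink / the tree's
  `AnticyclotomicInertiaAboveP`);
* `htriv` — `D_v̄` acts trivially on `(F/𝒪)(θquot)` for the quotient character of the residual pair `IsResidualPairOver`: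
  w6's `IndexInputsH0.smul_charModule_eq_of_mem_decomp` (p648414; KY Prop. 1.3.1 «`𝟙̃|_{G_p} = 𝟙`») at the stable line and
  embedding of LEAD g3's `ResidualPairStableLine.exists_stableLine_of_isResidualPairOver`
  (`smul_charModule_eq_of_mem_decomp_of_isResidualPairOver`).
Main statement **`lambdaInvariant_le_zpCorank_grSelmer_add_pow_quot`**: for `W/ℚ` globally minimal, `p` odd good anomalous
with the good-lattice normalisation, `K` imaginary quadratic with `p = v v̄`, `κ` anticyclotomic, `(θsub, θquot)` the residual
pair over `K`, representatives `τ i` (`i < p^c`) controlling the strict condition above `v̄` for `(F/𝒪)(θquot)` (v20's `hreps₃`),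
and ANY dual datum `DSquot` of `H¹_{𝓕_nr^{S₀}}(K_∞, (F/𝒪)(θquot))` finitely generated torsion with `μ = 0`:
`λ(DSquot.X) ≤ zpCorank (grSelmer κ (charModule ∅ θquot) v̄ S₀) + p^c`, where `grSelmer = datumStrictSelmer (ker κ) … (bdpData … v̄) S₀`
by `rfl` is the LEAD's `R((F/𝒪)(θquot))` — the (B1) input, `≤` direction, of w5's `IndexPlumbingShell.lambdaIdentity_of_mid_of_nrVsStrict`.
KY §1.4 (TeX L1240–1260): «`λ_nr(𝟙̃) = λ_str(𝟙̃) + s`» (here `≤`; `s = p^c`).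

HONEST FRAMING: helper theorems only (0 definitions, 0 named facts, 0 sorry); no summit statement, no BSD / IMC2 / KY Thm
1.4.1 (iii) is proved; 0 stubs / cells / labels move. References: [KellerYin2024] Prop. 1.3.1, §1.4, Lemma 1.3.5
(arXiv:2402.12781v2 TeX L877, L1019–1021, L1240–1260); [NeukirchANT1999] I §9 (9.4)–(9.6); [Brink2007] Cor. 1.
-/

set_option autoImplicit false
-- the route's Theorems namespace repeats the summit name by design (D-0017 nested layout)
set_option linter.dupNamespace false

noncomputable section

open scoped Classical AddSubgroup

namespace Summit.BirchSwinnertonDyer.BirchSwinnertonDyer.Theorems.IndexPlumbingNrVsStrict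

open Function NumberField IsDedekindDomain Field WeierstrassCurve
  Literature.NumberTheory.EllipticCurves Literature.NumberTheory.EllipticCurves.GreenbergSelmer
  Literature.NumberTheory.EllipticCurves.GreenbergVatsal2000 Literature.NumberTheory.GaloisRepresentations
  Literature.NumberTheory.EllipticCurves.KellerYin2024 Literature.NumberTheory.IwasawaTheory
  Literature.NumberTheory.EllipticCurves.Rank1Residual
  Summit.BirchSwinnertonDyer.Rank1Residual.X2.ResidualDevissageModules

/-! ## §1 The topological generator of `ker κ ⊓ D_v` modulo inertia -/

section Generator

variable {K : Type} [Field K] [NumberField K] {p : ℕ} [hp : Fact p.Prime] (κ : ZpExtension K p)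

/-- **A topological generator of `ker κ ⊓ D_v` modulo inertia** (w2 gen 3's `exists_generator_decomp_inf_kerSubgroup`,
transported from `D_v ⊓ ker κ` to `ker κ ⊓ D_v`): for `κ` ramified at `v` there is `γ ∈ ker κ ⊓ D_v` such that every OPEN
subgroup of `ker κ ⊓ D_v` containing `I_v ⊓ (ker κ ⊓ D_v)` and `γ` is everything (the residue field of `K_{∞,w}` is
generated over that of `K_v` by Frobenius powers). [cite: NeukirchANT1999, I §9 Prop. (9.4)] [cite: KellerYin2024, §1.3 Lemma 1.3.5 (arXiv:2402.12781v2 TeX L1019–1021)] -/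
theorem exists_generator_kerSubgroup_inf_decomp {v : HeightOneSpectrum (𝓞 K)} (hram : ∃ τ ∈ inertia v, κ τ ≠ 1) :
    ∃ γ : ↥(κ.kerSubgroup ⊓ decomp v),
      ∀ U : Subgroup ↥(κ.kerSubgroup ⊓ decomp v), IsOpen (U : Set ↥(κ.kerSubgroup ⊓ decomp v)) →
        (inertia v).subgroupOf (κ.kerSubgroup ⊓ decomp v) ≤ U → γ ∈ U → U = ⊤ := by
  obtain ⟨φ, hφ⟩ := HeightOneSpectrum.exists_isArithFrobAt_of_mem_primesAbove_holds (K := K) (v := v)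
    (adicCompletionPrime_mem_primesAbove K v)
  obtain ⟨γ', hgen⟩ := AnomalousLocalTorsion.exists_generator_decomp_inf_kerSubgroup κ hφ hram
  -- the two orderings of the intersection
  have hle : decomp v ⊓ κ.kerSubgroup ≤ κ.kerSubgroup ⊓ decomp v := le_of_eq (inf_comm _ _)
  have hge : κ.kerSubgroup ⊓ decomp v ≤ decomp v ⊓ κ.kerSubgroup := le_of_eq (inf_comm _ _)
  let e : ↥(decomp v ⊓ κ.kerSubgroup) →* ↥(κ.kerSubgroup ⊓ decomp v) := Subgroup.inclusion hle
  let e' : ↥(κ.kerSubgroup ⊓ decomp v) →* ↥(decomp v ⊓ κ.kerSubgroup) := Subgroup.inclusion hge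
  have hee' : ∀ x, e (e' x) = x := fun x ↦ Subtype.ext rfl
  refine ⟨e γ', fun U hU hNU hγU ↦ ?_⟩
  -- pull `U` back to `D_v ⊓ ker κ`
  set U' : Subgroup ↥(decomp v ⊓ κ.kerSubgroup) := U.comap e with hU'
  have hU'open : IsOpen (U' : Set ↥(decomp v ⊓ κ.kerSubgroup)) := by
    have h : (U' : Set ↥(decomp v ⊓ κ.kerSubgroup)) = e ⁻¹' (U : Set ↥(κ.kerSubgroup ⊓ decomp v)) := rfl
    rw [h]
    exact hU.preimage (continuous_inclusion hle)
  have hN'U' : (inertia v).subgroupOf (decomp v ⊓ κ.kerSubgroup) ≤ U' := by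
    intro x hx
    rw [hU', Subgroup.mem_comap]
    exact hNU (Subgroup.mem_subgroupOf.2 (Subgroup.mem_subgroupOf.1 hx))
  have hγ'U' : γ' ∈ U' := by rw [hU', Subgroup.mem_comap]; exact hγU
  have htop := hgen U' hU'open hN'U' hγ'U'
  rw [eq_top_iff]
  intro x _
  have hx : e' x ∈ U' := by rw [htop]; exact Subgroup.mem_top _
  rw [hU', Subgroup.mem_comap, hee'] at hx
  exact hx

/-- **Anticyclotomic instance**: for `K` imaginary quadratic, `p` odd, `v̄ ∣ p` and `κ` THE anticyclotomic `ℤ_p`-extension,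
`κ(I_v̄) ≠ 1` (`ZpExtension.exists_mem_inertia_apply_ne_one_of_isAnticyclotomic`), so `ker κ ⊓ D_v̄` has a topological
generator modulo inertia. [cite: Brink2007, Cor. 1] [cite: NeukirchANT1999, I §9 Prop. (9.4)] -/
theorem exists_generator_kerSubgroup_inf_decomp_of_isAnticyclotomic (hK : IsImaginaryQuadratic K) (hp2 : p ≠ 2)
    (hκ : κ.IsAnticyclotomic) {vbar : HeightOneSpectrum (𝓞 K)} (hpvbar : ((p : ℕ) : 𝓞 K) ∈ vbar.asIdeal) :
    ∃ γ : ↥(κ.kerSubgroup ⊓ decomp vbar),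
      ∀ U : Subgroup ↥(κ.kerSubgroup ⊓ decomp vbar), IsOpen (U : Set ↥(κ.kerSubgroup ⊓ decomp vbar)) →
        (inertia vbar).subgroupOf (κ.kerSubgroup ⊓ decomp vbar) ≤ U → γ ∈ U → U = ⊤ := by
  obtain ⟨τ, hτ, hτne⟩ := ZpExtension.exists_mem_inertia_apply_ne_one_of_isAnticyclotomic hK hp2 κ hκ hpvbar
    (adicCompletionPrime_mem_primesAbove K vbar)
  refine exists_generator_kerSubgroup_inf_decomp κ ⟨τ, ?_, hτne⟩
  have e : inertia vbar = (adicCompletionPrime K vbar).inertia (absoluteGaloisGroup K) :=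
    (inertia_adicCompletionPrime_eq_map_absInertia K vbar).symm
  rw [e]
  exact hτ

end Generator

/-! ## §2 `D_v̄` acts trivially on `(F/𝒪)(θquot)` for the residual pair (from `IsResidualPairOver`) -/

section Trivial

variable (W : WeierstrassCurve ℚ) [W.IsElliptic] [W.IsGloballyMinimal] {p : ℕ} [hp : Fact p.Prime]
  {K : Type} [Field K] [NumberField K]

/-- **`D_v̄` acts trivially on `(F/𝒪)(θquot)`** for the quotient character of a residual pair `(θsub, θquot)` of `E_K[p]`
(`IsResidualPairOver`) at a good ANOMALOUS place with the good-lattice normalisation: w6's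
`IndexInputsH0.smul_charModule_eq_of_mem_decomp` at the stable line / embedding produced by LEAD g3's
`ResidualPairStableLine.exists_stableLine_of_isResidualPairOver` (KY Prop. 1.3.1, `𝟙̃|_{G_p} = 𝟙`).
[cite: KellerYin2024, Prop. 1.3.1 and §1.4 display (char to f) (arXiv:2402.12781v2 TeX L877, L1063–1087)] -/
theorem smul_charModule_eq_of_mem_decomp_of_isResidualPairOver (hp2 : p ≠ 2) (hanom : Anom W p)
    (hGL : ∀ Φ : AddSubgroup (geomTorsion W (p : ℤ)), IsRationalLine W p Φ → ¬ LineUnramifiedAt W p Φ)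
    (hK : IsImaginaryQuadratic K) {v vbar : HeightOneSpectrum (𝓞 K)} (hpv : ((p : ℕ) : 𝓞 K) ∈ v.asIdeal)
    (hpvbar : ((p : ℕ) : 𝓞 K) ∈ vbar.asIdeal) (hne : vbar ≠ v)
    {θsub θquot : FramedGaloisRep K (padicCoeffIntegers (∅ : Set (PadicAlgCl p))) 1}
    (hpair : IsResidualPairOver (W.baseChange K) p θsub θquot)
    {g : absoluteGaloisGroup K} (hg : g ∈ decomp (K := K) vbar) (x : charModule (∅ : Set (PadicAlgCl p)) θquot) :
    g • x = x := by
  haveI hEK : (W.baseChange K).IsElliptic := inferInstanceAs (W.map (algebraMap ℚ K)).IsElliptic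
  obtain ⟨Φ, hSub, -, -, ⟨j, hj, hinj, -⟩⟩ :=
    ResidualPairStableLine.exists_stableLine_of_isResidualPairOver (W.baseChange K) hpair
  exact IndexInputsH0.smul_charModule_eq_of_mem_decomp W θquot hp2 hanom hGL hK hpv hpvbar hne Φ hSub
    (fun σ ↦ (hpair.pow_sub_one σ).2) j hj hinj hg x

end Trivial

/-! ## §3 The (B1) input at the crux binders, `≤` direction -/

section Crux

variable (W : WeierstrassCurve ℚ) [W.IsElliptic] [W.IsGloballyMinimal] {p : ℕ} [hp : Fact p.Prime]
  {K : Type} [Field K] [NumberField K] (κ : ZpExtension K p)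

/-- **KY §1.4 «nr versus strict at `v̄`» for `𝟙̃ = θquot`, `≤` direction, AT THE CRUX BINDERS.** `W/ℚ` globally minimal,
`p` odd, good anomalous with the good-lattice normalisation (`hGL`), `K` imaginary quadratic with `p = v v̄`, `κ` the
anticyclotomic `ℤ_p`-extension, `(θsub, θquot)` the residual pair of `E_K[p]`, `τ i` (`i < p^c`) representatives controlling
the strict condition above `v̄` for `(F/𝒪)(θquot)` (v20's `hreps₃`), `DSquot` any dual datum of
`H¹_{𝓕_nr^{S₀}}(K_∞, (F/𝒪)(θquot))` which is finitely generated `Λ`-torsion with `μ = 0`. Then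
`λ(DSquot.X) ≤ zpCorank (grSelmer κ (charModule ∅ θquot) v̄ S₀) + p^c` (`grSelmer = datumStrictSelmer (ker κ) … (bdpData … v̄) S₀`,
the LEAD's `R((F/𝒪)(θquot))`). Composition of `lambdaInvariant_le_zpCorank_grSelmer_add_pow` (p649735) with §1–§2.
[cite: KellerYin2024, §1.4 (arXiv:2402.12781v2 TeX L1240–1260) and Rem. 1.2.2] [cite: Greenberg1989, §1 p. 98] -/
theorem lambdaInvariant_le_zpCorank_grSelmer_add_pow_quot (hp2 : p ≠ 2) (hanom : Anom W p)
    (hGL : ∀ Φ : AddSubgroup (geomTorsion W (p : ℤ)), IsRationalLine W p Φ → ¬ LineUnramifiedAt W p Φ)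
    (hK : IsImaginaryQuadratic K) {v vbar : HeightOneSpectrum (𝓞 K)} (hpv : ((p : ℕ) : 𝓞 K) ∈ v.asIdeal)
    (hpvbar : ((p : ℕ) : 𝓞 K) ∈ vbar.asIdeal) (hne : vbar ≠ v) (hκ : κ.IsAnticyclotomic) {γ : absoluteGaloisGroup K}
    {θsub θquot : FramedGaloisRep K (padicCoeffIntegers (∅ : Set (PadicAlgCl p))) 1}
    (hpair : IsResidualPairOver (W.baseChange K) p θsub θquot) (S₀ : Set (HeightOneSpectrum (𝓞 K)))
    (c : ℕ) (τ : ℕ → absoluteGaloisGroup K)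
    (hreps : ∀ x : subgroupH1 κ.kerSubgroup (charModule (∅ : Set (PadicAlgCl p)) θquot),
      (∀ i, i < p ^ c → resOfLe (charModule (∅ : Set (PadicAlgCl p)) θquot)
        (inf_le_left : κ.kerSubgroup ⊓ decomp vbar ≤ κ.kerSubgroup)
        (conjH1 κ.kerSubgroup (charModule (∅ : Set (PadicAlgCl p)) θquot) (τ i) x) = 0) →
        ∀ σ : absoluteGaloisGroup K, resOfLe (charModule (∅ : Set (PadicAlgCl p)) θquot)
          (inf_le_left : κ.kerSubgroup ⊓ decomp vbar ≤ κ.kerSubgroup)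
          (conjH1 κ.kerSubgroup (charModule (∅ : Set (PadicAlgCl p)) θquot) σ x) = 0)
    (DSquot : DatumDualData κ γ (charModule (∅ : Set (PadicAlgCl p)) θquot)
      (Castella2018.AcSelmer.bdpData (charModule (∅ : Set (PadicAlgCl p)) θquot) p vbar) S₀)
    [Module.Finite (IwasawaAlgebra p) DSquot.X] (htor : Module.IsTorsion (IwasawaAlgebra p) DSquot.X)
    (hμ : muInvariant p DSquot.X = 0) :
    lambdaInvariant p DSquot.X ≤
      zpCorank ↥(grSelmer κ (charModule (∅ : Set (PadicAlgCl p)) θquot) vbar S₀) p + p ^ c :=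
  lambdaInvariant_le_zpCorank_grSelmer_add_pow κ vbar S₀ θquot hpvbar c τ hreps
    (fun _ hg x ↦ smul_charModule_eq_of_mem_decomp_of_isResidualPairOver W hp2 hanom hGL hK hpv hpvbar hne hpair hg x)
    (exists_generator_kerSubgroup_inf_decomp_of_isAnticyclotomic κ hK hp2 hκ hpvbar) DSquot htor hμ

/-- **The same with the cotorsion facts in the `∀ D` form of the registered stub** (`stub_indexPlumbing`'s antecedent
`hSquot : ∀ D, Module.Finite ∧ IsTorsion ∧ μ = 0`, [PWL-θ] through KY Prop. 1.2.5): instantiate at `DSquot`.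
[cite: KellerYin2024, Thm. 1.4.1 (i)–(iii) (arXiv:2402.12781v2 TeX L1087–1098)] -/
theorem lambdaInvariant_le_zpCorank_grSelmer_add_pow_quot_of_forall (hp2 : p ≠ 2) (hanom : Anom W p)
    (hGL : ∀ Φ : AddSubgroup (geomTorsion W (p : ℤ)), IsRationalLine W p Φ → ¬ LineUnramifiedAt W p Φ)
    (hK : IsImaginaryQuadratic K) {v vbar : HeightOneSpectrum (𝓞 K)} (hpv : ((p : ℕ) : 𝓞 K) ∈ v.asIdeal)
    (hpvbar : ((p : ℕ) : 𝓞 K) ∈ vbar.asIdeal) (hne : vbar ≠ v) (hκ : κ.IsAnticyclotomic) {γ : absoluteGaloisGroup K}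
    {θsub θquot : FramedGaloisRep K (padicCoeffIntegers (∅ : Set (PadicAlgCl p))) 1}
    (hpair : IsResidualPairOver (W.baseChange K) p θsub θquot) (S₀ : Set (HeightOneSpectrum (𝓞 K)))
    (c : ℕ) (τ : ℕ → absoluteGaloisGroup K)
    (hreps : ∀ x : subgroupH1 κ.kerSubgroup (charModule (∅ : Set (PadicAlgCl p)) θquot),
      (∀ i, i < p ^ c → resOfLe (charModule (∅ : Set (PadicAlgCl p)) θquot)
        (inf_le_left : κ.kerSubgroup ⊓ decomp vbar ≤ κ.kerSubgroup)
        (conjH1 κ.kerSubgroup (charModule (∅ : Set (PadicAlgCl p)) θquot) (τ i) x) = 0) →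
        ∀ σ : absoluteGaloisGroup K, resOfLe (charModule (∅ : Set (PadicAlgCl p)) θquot)
          (inf_le_left : κ.kerSubgroup ⊓ decomp vbar ≤ κ.kerSubgroup)
          (conjH1 κ.kerSubgroup (charModule (∅ : Set (PadicAlgCl p)) θquot) σ x) = 0)
    (DSquot : DatumDualData κ γ (charModule (∅ : Set (PadicAlgCl p)) θquot)
      (Castella2018.AcSelmer.bdpData (charModule (∅ : Set (PadicAlgCl p)) θquot) p vbar) S₀)
    (hSquot : ∀ D : DatumDualData κ γ (charModule (∅ : Set (PadicAlgCl p)) θquot)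
        (Castella2018.AcSelmer.bdpData (charModule (∅ : Set (PadicAlgCl p)) θquot) p vbar) S₀,
      Module.Finite (IwasawaAlgebra p) D.X ∧ Module.IsTorsion (IwasawaAlgebra p) D.X ∧ muInvariant p D.X = 0) :
    lambdaInvariant p DSquot.X ≤
      zpCorank ↥(grSelmer κ (charModule (∅ : Set (PadicAlgCl p)) θquot) vbar S₀) p + p ^ c := by
  obtain ⟨hfg, htor, hμ⟩ := hSquot DSquot
  haveI := hfg
  exact lambdaInvariant_le_zpCorank_grSelmer_add_pow_quot W κ hp2 hanom hGL hK hpv hpvbar hne hκ hpair S₀ c τ hreps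
    DSquot htor hμ

end Crux

end Summit.BirchSwinnertonDyer.BirchSwinnertonDyer.Theorems.IndexPlumbingNrVsStrict

end
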